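import Summits.Ventures.PercRepro.Night2LocalThmE

/-!
# PercRepro — series pairs of a set and the pair count (k3) of Theorem E (night-2, gen 8)

For a finite set `S` of rank `u + 1` call two distinct non-coloops `x, y ∈ S` a **series pair** if
`ρ(S ∖ {x, y}) = u` (`SeriesPair`).  Facts:

* `seriesPair_trans`: the series relation is transitive (submodularity);
* `isCocircuit_of_seriesPair`: a series pair is a cocircuit of `M ↾ S`;
* `indep_coloops_union`: if every element of `X ⊆ S` has a series mate outside `X`, then `coloops S ∪ X` is
  independent (a circuit inside it would meet the cocircuit `{x, mate}` in exactly `{x}`);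
* **`card_seriesPairs_le`**: the series pairs number at most `(q+2−κ₀)(q+1−κ₀)/2` with `κ₀` the number of coloops
  of `S` (a maximal set `R` of pairwise non-series elements is a transversal; `X := S ∖ (coloops ∪ R)` has
  `|X| ≤ q+1−κ₀`, every pair lies inside `X` or joins `X` to its unique mate in `R`).
-/

namespace PercRepro.Shadow

open Finset PerFlat ThmH

variable {α : Type*} [DecidableEq α] {M : Matroid α} [M.Finite]

/-- The rank of a finite set as a natural number. -/
noncomputable def rkN (M : Matroid α) [M.Finite] (X : Finset α) : ℕ := (M.eRk (X : Set α)).toNat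

omit [DecidableEq α] in
/-- `eRk = rkN` as an extended natural. -/
theorem eRk_eq_rkN (X : Finset α) : M.eRk (X : Set α) = (rkN M X : ℕ∞) := by
  unfold rkN
  rw [ENat.coe_toNat (eRk_ne_top X)]

omit [DecidableEq α] in
/-- `rkN` is monotone. -/
theorem rkN_mono {X Y : Finset α} (h : X ⊆ Y) : rkN M X ≤ rkN M Y := by
  have := M.eRk_mono (show (X : Set α) ⊆ (Y : Set α) by exact_mod_cast h)
  rw [eRk_eq_rkN, eRk_eq_rkN] at this
  exact_mod_cast this

/-- Deleting one element lowers the rank by at most one. -/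
theorem rkN_erase_ge (X : Finset α) (e : α) : rkN M X ≤ rkN M (X.erase e) + 1 := by
  have h := M.eRk_insert_le_add_one e ((X.erase e : Finset α) : Set α)
  rw [eRk_eq_rkN] at h
  by_cases he : e ∈ X
  · have hX : ((X : Finset α) : Set α) = insert e ((X.erase e : Finset α) : Set α) := by
      rw [← Finset.coe_insert, Finset.insert_erase he]
    have h2 : M.eRk ((X : Finset α) : Set α) ≤ (rkN M (X.erase e) : ℕ∞) + 1 := by rw [hX]; exact h
    rw [eRk_eq_rkN] at h2
    exact_mod_cast h2
  · rw [Finset.erase_eq_of_notMem he]; omega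

/-- Submodularity for `rkN`. -/
theorem rkN_submod (X Y : Finset α) : rkN M (X ∩ Y) + rkN M (X ∪ Y) ≤ rkN M X + rkN M Y := by
  have h := M.eRk_submod (X : Set α) (Y : Set α)
  rw [← Finset.coe_inter, ← Finset.coe_union, eRk_eq_rkN, eRk_eq_rkN, eRk_eq_rkN, eRk_eq_rkN] at h
  exact_mod_cast h

/-! ## Series pairs -/

/-- `x, y` form a series pair of `S` (of rank `u + 1`): distinct non-coloops with `ρ(S ∖ {x, y}) = u`. -/
def SeriesPair (M : Matroid α) [M.Finite] (S : Finset α) (u : ℕ) (x y : α) : Prop :=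
  x ∈ S ∧ y ∈ S ∧ x ≠ y ∧ rkN M (S.erase x) = u + 1 ∧ rkN M (S.erase y) = u + 1 ∧
    rkN M (S \ {x, y}) = u

/-- The series relation is symmetric. -/
theorem SeriesPair.symm {S : Finset α} {u : ℕ} {x y : α} (h : SeriesPair M S u x y) : SeriesPair M S u y x := by
  obtain ⟨hx, hy, hxy, hrx, hry, hr⟩ := h
  refine ⟨hy, hx, hxy.symm, hry, hrx, ?_⟩
  rw [Finset.pair_comm]; exact hr

/-- **Transitivity of the series relation** (submodularity). -/
theorem seriesPair_trans {S : Finset α} {u : ℕ} {x y z : α} (hxy : SeriesPair M S u x y)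
    (hyz : SeriesPair M S u y z) (hxz : x ≠ z) : SeriesPair M S u x z := by
  obtain ⟨hx, hy, hxy', hrx, hry, hr1⟩ := hxy
  obtain ⟨-, hz, hyz', -, hrz, hr2⟩ := hyz
  refine ⟨hx, hz, hxz, hrx, hrz, ?_⟩
  have hinter : (S \ {x, y}) ∩ (S \ {y, z}) = S \ {x, y, z} := by
    ext e; simp only [Finset.mem_inter, Finset.mem_sdiff, Finset.mem_insert, Finset.mem_singleton]; tauto
  have hunion : (S \ {x, y}) ∪ (S \ {y, z}) = S.erase y := by
    ext e; simp only [Finset.mem_union, Finset.mem_sdiff, Finset.mem_insert, Finset.mem_singleton, Finset.mem_erase]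
    constructor
    · rintro (⟨he, h⟩ | ⟨he, h⟩)
      · exact ⟨fun h' => h (Or.inr h'), he⟩
      · exact ⟨fun h' => h (Or.inl h'), he⟩
    · rintro ⟨hey, he⟩
      by_cases hex : e = x
      · right; exact ⟨he, fun h => by rcases h with h | h; exact hey h; exact hxz (hex ▸ h)⟩
      · left; exact ⟨he, fun h => by rcases h with h | h; exact hex h; exact hey h⟩
  have hsub := rkN_submod (M := M) (S \ {x, y}) (S \ {y, z})
  rw [hinter, hunion, hr1, hr2, hry] at hsub
  -- S ∖ {x, z} : erase y gives S ∖ {x, y, z}; erase x from S.erase z gives S ∖ {x, z}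
  have h1 : (S \ {x, z}).erase y = S \ {x, y, z} := by
    ext e; simp only [Finset.mem_erase, Finset.mem_sdiff, Finset.mem_insert, Finset.mem_singleton]; tauto
  have h2 : (S.erase z).erase x = S \ {x, z} := by
    ext e; simp only [Finset.mem_erase, Finset.mem_sdiff, Finset.mem_insert, Finset.mem_singleton]; tauto
  have hup := rkN_erase_ge (M := M) (S \ {x, z}) y
  rw [h1] at hup
  have hdown := rkN_erase_ge (M := M) (S.erase z) x
  rw [h2, hrz] at hdown
  omega


/-! ## Series pairs are cocircuits of the restriction -/

omit [DecidableEq α] in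
/-- A subset of `S` of the same rank spans `S`. -/
theorem subset_closure_of_rkN_eq {S K : Finset α} (hS : S ⊆ gr M) (hK : K ⊆ S) (hr : rkN M K = rkN M S) :
    (S : Set α) ⊆ M.closure (K : Set α) := by
  intro e he
  by_contra hecl
  have heE : e ∈ M.E \ M.closure (K : Set α) := ⟨by rw [← coe_gr]; exact_mod_cast hS he, hecl⟩
  have h1 : M.eRk (insert e (K : Set α)) = M.eRk (K : Set α) + 1 := Matroid.eRk_insert_eq_add_one heE
  have h2 : M.eRk (insert e (K : Set α)) ≤ M.eRk (S : Set α) :=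
    M.eRk_mono (Set.insert_subset (by exact_mod_cast he) (by exact_mod_cast hK))
  rw [h1, eRk_eq_rkN, eRk_eq_rkN, hr] at h2
  have h3 : rkN M S + 1 ≤ rkN M S := by exact_mod_cast h2
  omega

/-- In `M ↾ S`, a set `I ⊆ S` is coindependent iff `S ⊆ cl (S ∖ I)`. -/
theorem restrict_coindep_iff {S I : Finset α} (hS : S ⊆ gr M) (hI : I ⊆ S) :
    (M.restrict (S : Set α)).Coindep (I : Set α) ↔ (S : Set α) ⊆ M.closure ((S \ I : Finset α) : Set α) := by
  have hSE : (S : Set α) ⊆ M.E := by rw [← coe_gr]; exact_mod_cast hS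
  rw [Matroid.coindep_iff_compl_spanning (by rw [Matroid.restrict_ground_eq]; exact_mod_cast hI),
    Matroid.spanning_iff_closure_eq (by rw [Matroid.restrict_ground_eq]; exact Set.sdiff_subset),
    Matroid.restrict_ground_eq, Matroid.restrict_closure_eq M Set.sdiff_subset hSE, ← Finset.coe_sdiff]
  constructor
  · intro h e he
    have : e ∈ M.closure ((S \ I : Finset α) : Set α) ∩ (S : Set α) := by rw [h]; exact he
    exact this.1
  · intro h
    apply Set.Subset.antisymm Set.inter_subset_right
    intro e he
    exact ⟨h he, he⟩

/-- **A series pair is a cocircuit of `M ↾ S`.** -/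
theorem isCocircuit_of_seriesPair {S : Finset α} (hS : S ⊆ gr M) {u : ℕ} (hSr : rkN M S = u + 1) {x y : α}
    (h : SeriesPair M S u x y) : (M.restrict (S : Set α)).IsCocircuit ({x, y} : Set α) := by
  obtain ⟨hx, hy, hxy, hrx, hry, hr⟩ := h
  rw [Matroid.isCocircuit_def, Matroid.isCircuit_iff_dep_forall_sdiff_singleton_indep]
  have hpair : (({x, y} : Finset α) : Set α) = ({x, y} : Set α) := Finset.coe_pair
  have hsub : ({x, y} : Finset α) ⊆ S := by
    intro e he
    rw [Finset.mem_insert, Finset.mem_singleton] at he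
    rcases he with rfl | rfl
    · exact hx
    · exact hy
  constructor
  · -- dependent in the dual: S ⊄ cl (S ∖ {x, y})
    rw [Matroid.dep_iff]
    refine ⟨?_, by rw [Matroid.dual_ground, Matroid.restrict_ground_eq, ← hpair]; exact_mod_cast hsub⟩
    rw [← Matroid.coindep_def, ← hpair, restrict_coindep_iff hS hsub]
    intro hcl
    have h1 : M.eRk (S : Set α) ≤ M.eRk (M.closure ((S \ {x, y} : Finset α) : Set α)) := M.eRk_mono hcl
    rw [Matroid.eRk_closure_eq, eRk_eq_rkN, eRk_eq_rkN, hr, hSr] at h1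
    have : u + 1 ≤ u := by exact_mod_cast h1
    omega
  · -- every proper subset is coindependent
    intro e he
    have hcase : ({x, y} : Set α) \ {e} = ({x} : Set α) ∨ ({x, y} : Set α) \ {e} = ({y} : Set α) := by
      rw [Set.mem_insert_iff, Set.mem_singleton_iff] at he
      rcases he with rfl | rfl
      · right
        ext a; simp only [Set.mem_sdiff, Set.mem_insert_iff, Set.mem_singleton_iff]
        constructor
        · rintro ⟨h1 | h1, h2⟩
          · exact absurd h1 h2
          · exact h1
        · rintro rfl; exact ⟨Or.inr rfl, fun h => hxy h.symm⟩
      · left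
        ext a; simp only [Set.mem_sdiff, Set.mem_insert_iff, Set.mem_singleton_iff]
        constructor
        · rintro ⟨h1 | h1, h2⟩
          · exact h1
          · exact absurd h1 h2
        · rintro rfl; exact ⟨Or.inl rfl, hxy⟩
    have key : ∀ w ∈ S, rkN M (S.erase w) = u + 1 → (M.restrict (S : Set α))✶.Indep ({w} : Set α) := by
      intro w hw hrw
      rw [← Matroid.coindep_def]
      have hw1 : ({w} : Finset α) ⊆ S := Finset.singleton_subset_iff.2 hw
      have hcoe : (({w} : Finset α) : Set α) = ({w} : Set α) := Finset.coe_singleton w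
      rw [← hcoe, restrict_coindep_iff hS hw1]
      have hse : S \ {w} = S.erase w := Finset.sdiff_singleton_eq_erase w S
      rw [hse]
      exact subset_closure_of_rkN_eq hS (Finset.erase_subset _ _) (by rw [hrw, hSr])
    rcases hcase with h1 | h1
    · rw [h1]; exact key x hx hrx
    · rw [h1]; exact key y hy hry


/-! ## The transversal is independent -/

/-- A coloop of `S` lies in no circuit contained in `S`. -/
theorem notMem_circuit_of_mem_coloops {S : Finset α} {C : Set α} (hC : M.IsCircuit C) (hCS : C ⊆ (S : Set α))
    {e : α} (he : e ∈ coloops M S) : e ∉ C := by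
  intro heC
  rw [mem_coloops] at he
  apply he.2
  have h1 : e ∈ M.closure (C \ {e}) := hC.mem_closure_sdiff_singleton_of_mem heC
  have h2 : M.closure (C \ {e}) ⊆ M.closure (((S.erase e : Finset α)) : Set α) := by
    apply M.closure_mono
    rw [Finset.coe_erase]
    exact Set.sdiff_subset_sdiff_left hCS
  rw [← Finset.mem_coe, coe_clF]
  exact h2 h1

/-- **The coloops together with a set whose elements all have series mates outside it form an independent
set.** -/
theorem indep_coloops_union {S X : Finset α} (hS : S ⊆ gr M) {u : ℕ} (hSr : rkN M S = u + 1) (hX : X ⊆ S)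
    (hmate : ∀ x ∈ X, ∃ r ∈ S, r ∉ X ∧ SeriesPair M S u x r) :
    M.Indep ((coloops M S ∪ X : Finset α) : Set α) := by
  have hSE : (S : Set α) ⊆ M.E := by rw [← coe_gr]; exact_mod_cast hS
  have hsubS : coloops M S ∪ X ⊆ S := Finset.union_subset (Finset.filter_subset _ _) hX
  have hground : ((coloops M S ∪ X : Finset α) : Set α) ⊆ M.E := by
    rw [← coe_gr]; exact_mod_cast hsubS.trans hS
  rw [Matroid.indep_iff_forall_subset_not_isCircuit hground]
  intro C hCsub hC
  have hCS : C ⊆ (S : Set α) := hCsub.trans (by exact_mod_cast hsubS)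
  -- C avoids the coloops, so C ⊆ X
  have hCX : C ⊆ (X : Set α) := by
    intro e he
    have : e ∈ ((coloops M S ∪ X : Finset α) : Set α) := hCsub he
    rw [Finset.coe_union, Set.mem_union] at this
    rcases this with h | h
    · exact absurd he (notMem_circuit_of_mem_coloops hC hCS h)
    · exact h
  obtain ⟨x, hxC⟩ := hC.nonempty
  have hxX : x ∈ X := by exact_mod_cast hCX hxC
  obtain ⟨r, hrS, hrX, hpair⟩ := hmate x hxX
  have hcoc := isCocircuit_of_seriesPair hS hSr hpair
  have hCres : (M.restrict (S : Set α)).IsCircuit C := by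
    rw [Matroid.restrict_isCircuit_iff hSE]; exact ⟨hC, hCS⟩
  apply hCres.inter_isCocircuit_ne_singleton (e := x) hcoc
  ext a
  simp only [Set.mem_inter_iff, Set.mem_insert_iff, Set.mem_singleton_iff]
  constructor
  · rintro ⟨haC, rfl | rfl⟩
    · rfl
    · exact absurd (by exact_mod_cast hCX haC : a ∈ X) hrX
  · rintro rfl; exact ⟨hxC, Or.inl rfl⟩


/-! ## A transversal of the series classes -/

/-- A set with no series pair inside it. -/
def NoSeries (M : Matroid α) [M.Finite] (S : Finset α) (u : ℕ) (R : Finset α) : Prop :=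
  ∀ x ∈ R, ∀ y ∈ R, ¬ SeriesPair M S u x y

/-- The non-coloops of `S`. -/
noncomputable def nonColoops (M : Matroid α) [M.Finite] (S : Finset α) : Finset α := S \ coloops M S

/-- A series pair consists of non-coloops. -/
theorem mem_nonColoops_of_seriesPair {S : Finset α} (hS : S ⊆ gr M) {u : ℕ} (hSr : rkN M S = u + 1) {x y : α}
    (h : SeriesPair M S u x y) : x ∈ nonColoops M S := by
  obtain ⟨hx, -, -, hrx, -, -⟩ := h
  unfold nonColoops
  rw [Finset.mem_sdiff]
  refine ⟨hx, fun hc => ?_⟩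
  rw [mem_coloops] at hc
  apply hc.2
  have := subset_closure_of_rkN_eq hS (Finset.erase_subset x S) (by rw [hrx, hSr])
  rw [← Finset.mem_coe, coe_clF]
  exact this (by exact_mod_cast hx)

open scoped Classical in
/-- **A maximal no-series subset of the non-coloops is a transversal**: every non-coloop outside it has a
series mate inside it, and that mate is unique. -/
theorem exists_transversal (S : Finset α) (u : ℕ) :
    ∃ R ⊆ nonColoops M S, NoSeries M S u R ∧
      (∀ x ∈ nonColoops M S, x ∉ R → ∃ r ∈ R, SeriesPair M S u x r) ∧
      (∀ x ∈ nonColoops M S, ∀ r ∈ R, ∀ r' ∈ R, SeriesPair M S u x r → SeriesPair M S u x r' → r = r') := by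
  -- a no-series subset of maximum cardinality
  have hne : ((nonColoops M S).powerset.filter (fun R => NoSeries M S u R)).Nonempty :=
    ⟨∅, by rw [Finset.mem_filter, Finset.mem_powerset]; exact ⟨Finset.empty_subset _, fun x hx => absurd hx (Finset.notMem_empty x)⟩⟩
  obtain ⟨R, hR, hmax⟩ := Finset.exists_max_image _ (fun R : Finset α => R.card) hne
  rw [Finset.mem_filter, Finset.mem_powerset] at hR
  refine ⟨R, hR.1, hR.2, ?_, ?_⟩
  · intro x hx hxR
    by_contra hno
    push Not at hno
    -- insert x R is still no-series and larger
    have hins : NoSeries M S u (insert x R) := by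
      intro a ha b hb hab
      rw [Finset.mem_insert] at ha hb
      rcases ha with rfl | ha <;> rcases hb with rfl | hb
      · exact hab.2.2.1 rfl
      · exact hno b hb hab
      · exact hno a ha hab.symm
      · exact hR.2 a ha b hb hab
    have hmem : insert x R ∈ (nonColoops M S).powerset.filter (fun R => NoSeries M S u R) := by
      rw [Finset.mem_filter, Finset.mem_powerset]
      exact ⟨Finset.insert_subset hx hR.1, hins⟩
    have := hmax _ hmem
    rw [Finset.card_insert_of_notMem hxR] at this
    omega
  · intro x hx r hr r' hr' h1 h2
    by_contra hne'
    exact hR.2 r hr r' hr' (seriesPair_trans h1.symm h2 hne')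

end PercRepro.Shadow
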